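import Summits.KontsevichZagierPeriods.KontsevichZagierPeriods.Theorems.LinRedNormalFormArrangementNormalFormSeparateThreeHIBrick
import Summits.KontsevichZagierPeriods.KontsevichZagierPeriods.Theorems.LinRedNormalFormArrangementNormalFormSeparateThreeHITonelli
import Summits.KontsevichZagierPeriods.KontsevichZagierPeriods.Theorems.LinRedNormalFormArrangementNormalFormSeparateThreeHICone

/-!
# The Taylor pieces in the sheared coordinates: letters, fibre integrals and moderate fibres

(Line `janus-bands`, crux `ArrangementNormalForm`, stub `stub_separateThreeZero`, part `HIPieces` of
the termwise numerator split `separateThree_hI` under the rim condition.)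

The integrand of a terminal piece in the sheared coordinates `p = (v, w)` is
`Fform p = (∑_{i<N} Qᵢ(v) w^i) / Wt(v) · w^{-n}` with `Wt = ∏ⱼ Lⱼ^{eⱼ}` the block of the
`x′`-letters `Lⱼ(v) = lval j v`, and the `i`-th Taylor piece is
`tpiece i p = Qᵢ(v) / Wt(v) · w^i / w^n`. This part defines these, the fibre integrals `FI i v`,
`FF v` of their absolute values over the vertical fibre of the cell, the reduction of a bound
`FI i ≤ C · FF` to a statement about polynomials in `w` on the fibre (`FI_le_of_fibre`; the letters
drop out), the two-sided bounds of the letter block near a base point (`Wt_upper`, `Wt_lower`), and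
the MODERATE FIBRE lemma (`moderate_fibre`, registered as `separateThree_pieces`): on a fibre
containing a dilated interval `ρ[a₀, b₀]` and contained in `ρ(A₁, B₁)`, `0 < A₁`, every term is
dominated (rescaled norm equivalence `SepThree.exists_coeff_scale_le`).
-/

noncomputable section

open Set MeasureTheory
open scoped ENNReal

namespace Summit.KontsevichZagierPeriods.ArrangementNormalForm.JanusBands

namespace SepThree

/-! ### Letters, numerator, pieces -/

section Defs

variable {m : ℕ} (κ : Fin m → Fin 2 → ℝ) (μ : Fin m → ℝ) (e : Fin m → ℕ)
  (N : ℕ) (q : ℕ → MvPolynomial (Fin 2) ℝ) (n : ℕ)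

/-- The `j`-th `x′`-letter at the base point `v`. -/
def lval (j : Fin m) (v : Fin 2 → ℝ) : ℝ := κ j 0 * v 0 + κ j 1 * v 1 + μ j

/-- The letter block `∏ⱼ Lⱼ(v)^{eⱼ}`. -/
def Wt (v : Fin 2 → ℝ) : ℝ := ∏ j, lval κ μ j v ^ e j

/-- The `i`-th Taylor coefficient as a real polynomial function of the base point. -/
def Qv (i : ℕ) (v : Fin 2 → ℝ) : ℝ := MvPolynomial.eval v (q i)

/-- The integrand in the sheared coordinates. -/
def Fform (p : (Fin 2 → ℝ) × ℝ) : ℝ :=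
  psum N (fun i => Qv q i p.1) p.2 / Wt κ μ e p.1 * (1 / p.2) ^ n

/-- The `i`-th Taylor tpiece in the sheared coordinates. -/
def tpiece (i : ℕ) (p : (Fin 2 → ℝ) × ℝ) : ℝ := Qv q i p.1 / Wt κ μ e p.1 * (p.2 ^ i / p.2 ^ n)

/-- The fibre integral of the absolute `i`-th tpiece. -/
def FI (Ω : Set ((Fin 2 → ℝ) × ℝ)) (i : ℕ) (v : Fin 2 → ℝ) : ℝ≥0∞ :=
  ∫⁻ w in fib Ω v, ‖tpiece κ μ e q n i (v, w)‖ₑ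

/-- The fibre integral of the absolute integrand. -/
def FF (Ω : Set ((Fin 2 → ℝ) × ℝ)) (v : Fin 2 → ℝ) : ℝ≥0∞ :=
  ∫⁻ w in fib Ω v, ‖Fform κ μ e N q n (v, w)‖ₑ

/-- A letter is continuous. -/
theorem continuous_lval (j : Fin m) : Continuous (lval κ μ j) := by unfold lval; fun_prop

/-- The letter block is continuous. -/
theorem continuous_Wt : Continuous (Wt κ μ e) := by
  unfold Wt
  exact continuous_finsetProd _ fun j _ => (continuous_lval κ μ j).pow _

/-- The Taylor coefficients are continuous. -/
theorem continuous_Qv (i : ℕ) : Continuous (Qv q i) := by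
  unfold Qv
  exact MvPolynomial.continuous_eval (q i)

/-- The numerator is measurable. -/
theorem measurable_psum_Qv : Measurable fun p : (Fin 2 → ℝ) × ℝ => psum N (fun i => Qv q i p.1) p.2 := by
  unfold psum
  refine Finset.measurable_sum _ fun i _ => ?_
  exact ((continuous_Qv q i).measurable.comp measurable_fst).mul (measurable_snd.pow_const _)

/-- The integrand is measurable. -/
theorem measurable_Fform : Measurable (Fform κ μ e N q n) := by
  unfold Fform
  refine ((measurable_psum_Qv N q).div ((continuous_Wt κ μ e).measurable.comp measurable_fst)).mul ?_
  exact (measurable_const.div measurable_snd).pow_const _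

/-- The pieces are measurable. -/
theorem measurable_tpiece (i : ℕ) : Measurable (tpiece κ μ e q n i) := by
  unfold tpiece
  refine (((continuous_Qv q i).measurable.comp measurable_fst).div
    ((continuous_Wt κ μ e).measurable.comp measurable_fst)).mul ?_
  exact (measurable_snd.pow_const _).div (measurable_snd.pow_const _)

/-- **Reduction to the fibre polynomial.** A domination of the `i`-th weighted term by the weighted
numerator on the fibre gives `FI i v ≤ C · FF v`: the letters drop out. -/
theorem FI_le_of_fibre {Ω : Set ((Fin 2 → ℝ) × ℝ)} {v : Fin 2 → ℝ} {i : ℕ} {C : ℝ≥0∞}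
    (h : ∫⁻ w in fib Ω v, ‖Qv q i v * (w ^ i / w ^ n)‖ₑ ≤
      C * ∫⁻ w in fib Ω v, ‖psum N (fun j => Qv q j v) w * (1 / w) ^ n‖ₑ) :
    FI κ μ e q n Ω i v ≤ C * FF κ μ e N q n Ω v := by
  unfold FI FF tpiece Fform
  have h1 : ∀ w : ℝ, ‖Qv q i v / Wt κ μ e v * (w ^ i / w ^ n)‖ₑ =
      ‖(Wt κ μ e v)⁻¹‖ₑ * ‖Qv q i v * (w ^ i / w ^ n)‖ₑ := fun w => by
    rw [← enorm_mul]; congr 1; ring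
  have h2 : ∀ w : ℝ, ‖psum N (fun j => Qv q j v) w / Wt κ μ e v * (1 / w) ^ n‖ₑ =
      ‖(Wt κ μ e v)⁻¹‖ₑ * ‖psum N (fun j => Qv q j v) w * (1 / w) ^ n‖ₑ := fun w => by
    rw [← enorm_mul]; congr 1; ring
  simp_rw [h1, h2]
  have hm1 : Measurable fun w : ℝ => ‖Qv q i v * (w ^ i / w ^ n)‖ₑ :=
    (measurable_const.mul ((measurable_id.pow_const _).div (measurable_id.pow_const _))).enorm
  rw [lintegral_const_mul _ hm1, lintegral_const_mul _ (measurable_rhs N n _), mul_left_comm]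
  gcongr

/-- The fibre integral of a tpiece over an empty fibre vanishes. -/
theorem FI_eq_zero_of_empty {Ω : Set ((Fin 2 → ℝ) × ℝ)} {v : Fin 2 → ℝ} (i : ℕ) (h : fib Ω v = ∅) :
    FI κ μ e q n Ω i v = 0 := by
  unfold FI; rw [h]; simp

/-! ### The letter block near a base point -/

/-- A letter is affine: `L(v₀ + u) = L(v₀) + (κ u)`. -/
theorem lval_add (j : Fin m) (v₀ u : Fin 2 → ℝ) :
    lval κ μ j (v₀ + u) = lval κ μ j v₀ + (κ j 0 * u 0 + κ j 1 * u 1) := by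
  simp only [lval, Pi.add_apply]; ring

/-- The linear part of a letter is bounded by `(|κ₀| + |κ₁|) ‖u‖`. -/
theorem abs_klin_le (j : Fin m) (u : Fin 2 → ℝ) : |κ j 0 * u 0 + κ j 1 * u 1| ≤ (|κ j 0| + |κ j 1|) * ‖u‖ := by
  have h0 : |u 0| ≤ ‖u‖ := by rw [← Real.norm_eq_abs]; exact norm_le_pi_norm u 0
  have h1 : |u 1| ≤ ‖u‖ := by rw [← Real.norm_eq_abs]; exact norm_le_pi_norm u 1
  calc |κ j 0 * u 0 + κ j 1 * u 1| ≤ |κ j 0 * u 0| + |κ j 1 * u 1| := abs_add_le _ _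
    _ = |κ j 0| * |u 0| + |κ j 1| * |u 1| := by rw [abs_mul, abs_mul]
    _ ≤ |κ j 0| * ‖u‖ + |κ j 1| * ‖u‖ := by gcongr
    _ = (|κ j 0| + |κ j 1|) * ‖u‖ := by ring

/-- The order of the letter block at the base point `v₀`. -/
def Eord (v₀ : Fin 2 → ℝ) : ℕ := ∑ j ∈ Finset.univ.filter (fun j => lval κ μ j v₀ = 0), e j

/-- **Upper bound of the letter block**: `|Wt(v₀ + u)| ≤ CW ‖u‖^E` on the unit ball, `E` the
order of the block at `v₀`. -/
theorem Wt_upper (v₀ : Fin 2 → ℝ) : ∃ CW > 0, ∀ u : Fin 2 → ℝ, ‖u‖ ≤ 1 →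
    |Wt κ μ e (v₀ + u)| ≤ CW * ‖u‖ ^ Eord κ μ e v₀ := by
  classical
  set K : Fin m → ℝ := fun j => |κ j 0| + |κ j 1| + |lval κ μ j v₀| + 1 with hK
  have hK1 : ∀ j, 1 ≤ K j := fun j => by
    simp only [hK]
    linarith [abs_nonneg (κ j 0), abs_nonneg (κ j 1), abs_nonneg (lval κ μ j v₀)]
  refine ⟨∏ j, K j ^ e j, Finset.prod_pos fun j _ => pow_pos (by linarith [hK1 j]) _, fun u hu => ?_⟩
  have hfac : ∀ j, |lval κ μ j (v₀ + u)| ≤ K j := fun j => by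
    rw [lval_add]
    calc |lval κ μ j v₀ + (κ j 0 * u 0 + κ j 1 * u 1)| ≤ |lval κ μ j v₀| + |κ j 0 * u 0 + κ j 1 * u 1| :=
          abs_add_le _ _
      _ ≤ |lval κ μ j v₀| + (|κ j 0| + |κ j 1|) * ‖u‖ := by gcongr; exact abs_klin_le κ j u
      _ ≤ |lval κ μ j v₀| + (|κ j 0| + |κ j 1|) * 1 :=
          add_le_add_right (mul_le_mul_of_nonneg_left hu (add_nonneg (abs_nonneg _) (abs_nonneg _))) _
      _ ≤ K j := by simp only [hK]; linarith
  have hvan : ∀ j, lval κ μ j v₀ = 0 → |lval κ μ j (v₀ + u)| ≤ K j * ‖u‖ := fun j hj => by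
    rw [lval_add, hj, zero_add]
    calc |κ j 0 * u 0 + κ j 1 * u 1| ≤ (|κ j 0| + |κ j 1|) * ‖u‖ := abs_klin_le κ j u
      _ ≤ K j * ‖u‖ := by gcongr; simp only [hK]; linarith [abs_nonneg (lval κ μ j v₀)]
  unfold Wt Eord
  rw [Finset.abs_prod, ← Finset.prod_filter_mul_prod_filter_not Finset.univ (fun j => lval κ μ j v₀ = 0),
    ← Finset.prod_filter_mul_prod_filter_not Finset.univ (fun j => lval κ μ j v₀ = 0) (fun j => K j ^ e j),
    ← Finset.prod_pow_eq_pow_sum, mul_assoc, mul_comm (∏ j ∈ Finset.univ.filter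
      (fun j => ¬lval κ μ j v₀ = 0), K j ^ e j), ← mul_assoc, ← Finset.prod_mul_distrib]
  refine mul_le_mul ?_ ?_ (Finset.prod_nonneg fun j _ => by positivity) (Finset.prod_nonneg fun j _ => by positivity)
  · refine Finset.prod_le_prod (fun j _ => by positivity) fun j hj => ?_
    rw [abs_pow, ← mul_pow]
    exact pow_le_pow_left₀ (abs_nonneg _) (hvan j (Finset.mem_filter.1 hj).2) _
  · refine Finset.prod_le_prod (fun j _ => by positivity) fun j _ => ?_
    rw [abs_pow]
    exact pow_le_pow_left₀ (abs_nonneg _) (hfac j) _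

/-- **Lower bound of the letter block** on a set of displacements where the vanishing letters are
transversal: if `c ‖u‖ ≤ |κⱼ u|` for the letters vanishing at `v₀`, then `cW ‖u‖^E ≤ |Wt(v₀ + u)|`
for `‖u‖` small. -/
theorem Wt_lower (v₀ : Fin 2 → ℝ) {c : ℝ} (hc : 0 < c) :
    ∃ δ > 0, ∃ cW > 0, ∀ u : Fin 2 → ℝ, ‖u‖ < δ →
      (∀ j, lval κ μ j v₀ = 0 → e j ≠ 0 → c * ‖u‖ ≤ |κ j 0 * u 0 + κ j 1 * u 1|) →
      cW * ‖u‖ ^ Eord κ μ e v₀ ≤ |Wt κ μ e (v₀ + u)| := by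
  classical
  -- non-vanishing letters stay away from zero
  set K : Fin m → ℝ := fun j => |κ j 0| + |κ j 1| + 1 with hK
  have hK0 : ∀ j, 0 < K j := fun j => by simp only [hK]; positivity
  set δ' : Fin m → ℝ := fun j => if lval κ μ j v₀ = 0 then 1 else |lval κ μ j v₀| / (2 * K j) with hδ'
  have hδ'0 : ∀ j, 0 < δ' j := fun j => by
    simp only [hδ']; split_ifs with h
    · exact one_pos
    · exact div_pos (abs_pos.2 h) (by linarith [hK0 j])
  obtain ⟨δ, hδ0, hδ⟩ := exists_pos_le_all δ' hδ'0
  set lo : Fin m → ℝ := fun j => if lval κ μ j v₀ = 0 then (if e j = 0 then 1 else c)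
    else |lval κ μ j v₀| / 2 with hlo
  have hlo0 : ∀ j, 0 < lo j := fun j => by
    simp only [hlo]; split_ifs with h h'
    · exact one_pos
    · exact hc
    · exact half_pos (abs_pos.2 h)
  refine ⟨δ, hδ0, ∏ j, lo j ^ e j, Finset.prod_pos fun j _ => pow_pos (hlo0 j) _, fun u hu htr => ?_⟩
  have hfac : ∀ j, (lo j * (if lval κ μ j v₀ = 0 then ‖u‖ else 1)) ^ e j ≤ |lval κ μ j (v₀ + u)| ^ e j := by
    intro j
    by_cases hj : lval κ μ j v₀ = 0
    · by_cases hej : e j = 0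
      · simp [hej]
      · refine pow_le_pow_left₀ (by positivity) ?_ _
        simp only [hlo, if_pos hj, if_neg hej]
        rw [lval_add, hj, zero_add]
        exact htr j hj hej
    · refine pow_le_pow_left₀ (by positivity) ?_ _
      simp only [hlo, if_neg hj, mul_one]
      have huj : ‖u‖ < |lval κ μ j v₀| / (2 * K j) := by
        have := hδ j; simp only [hδ', if_neg hj] at this; exact hu.trans_le this
      rw [lval_add]
      have h1 := abs_klin_le κ j u
      have h2 : (|κ j 0| + |κ j 1|) * ‖u‖ ≤ K j * ‖u‖ :=
        mul_le_mul_of_nonneg_right (by simp only [hK]; linarith) (norm_nonneg _)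
      have h3 : K j * ‖u‖ < |lval κ μ j v₀| / 2 := by
        have h5 := mul_lt_mul_of_pos_left huj (hK0 j)
        have hKj := (hK0 j).ne'
        have h6 : K j * (|lval κ μ j v₀| / (2 * K j)) = |lval κ μ j v₀| / 2 := by
          field_simp
        linarith
      have h4 := abs_sub_abs_le_abs_sub (lval κ μ j v₀) (-(κ j 0 * u 0 + κ j 1 * u 1))
      rw [abs_neg, sub_neg_eq_add] at h4
      linarith
  unfold Wt Eord
  rw [Finset.abs_prod]
  calc (∏ j, lo j ^ e j) * ‖u‖ ^ ∑ j ∈ Finset.univ.filter (fun j => lval κ μ j v₀ = 0), e j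
      = ∏ j, (lo j * (if lval κ μ j v₀ = 0 then ‖u‖ else 1)) ^ e j := by
        rw [← Finset.prod_pow_eq_pow_sum, Finset.prod_filter, ← Finset.prod_mul_distrib]
        refine Finset.prod_congr rfl fun j _ => ?_
        split_ifs with h
        · rw [mul_pow]
        · rw [mul_one, mul_one]
    _ ≤ ∏ j, |lval κ μ j (v₀ + u)| ^ e j :=
        Finset.prod_le_prod (fun j _ => by positivity) fun j _ => hfac j
    _ = ∏ j, |lval κ μ j (v₀ + u) ^ e j| := Finset.prod_congr rfl fun j _ => (abs_pow _ _).symm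

end Defs

/-! ### Moderate fibres -/

/-- **Moderate fibres.** On a fibre `I` with `ρ[a₀, b₀] ⊆ I ⊆ ρ(A₁, B₁)`, `0 < A₁`, every
weighted term `|Qᵢ| w^i/w^n` is dominated in `L¹(I)` by `|∑ Qⱼ w^j| w^{-n}`, uniformly in `ρ > 0`
and in the coefficients. -/
theorem moderate_fibre (N n : ℕ) {a₀ b₀ A₁ B₁ : ℝ} (hA : 0 < A₁) (h1 : A₁ < a₀) (h2 : a₀ < b₀)
    (h3 : b₀ < B₁) : ∃ C : ℝ≥0∞, C ≠ ∞ ∧ ∀ (Q : ℕ → ℝ) (ρ : ℝ), 0 < ρ → ∀ (I : Set ℝ), MeasurableSet I →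
      Icc (ρ * a₀) (ρ * b₀) ⊆ I → I ⊆ Ioo (ρ * A₁) (ρ * B₁) → ∀ i < N,
        ∫⁻ w in I, ‖Q i * (w ^ i / w ^ n)‖ₑ ≤ C * ∫⁻ w in I, ‖psum N Q w * (1 / w) ^ n‖ₑ := by
  obtain ⟨Cs, hCs, hsc⟩ := exists_coeff_scale_le N h2
  have hB0 : 0 < B₁ := hA.trans (h1.trans (h2.trans h3))
  -- the constant: `Cs · B₁^N (B₁ - A₁) B₁^n / A₁^n` works for all `i < N` since `B₁^i ≤ max 1 B₁ ^ N`
  set M := max 1 B₁ with hM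
  have hM1 : 1 ≤ M := le_max_left _ _
  set Cr : ℝ := Cs * (M ^ N * (B₁ - A₁) / A₁ ^ n) * B₁ ^ n with hCr
  have hCr0 : 0 ≤ Cr := by
    simp only [hCr]
    exact mul_nonneg (mul_nonneg hCs.le (div_nonneg (mul_nonneg (by positivity) (by linarith))
      (by positivity))) (by positivity)
  refine ⟨ENNReal.ofReal Cr, ENNReal.ofReal_ne_top, fun Q ρ hρ I hI hin hout i hi => ?_⟩
  have hρA : 0 < ρ * A₁ := mul_pos hρ hA
  -- pointwise bound of the weighted term on `I`
  have hpt : ∀ w ∈ I, ‖Q i * (w ^ i / w ^ n)‖ₑ ≤ ENNReal.ofReal (|Q i| * ((ρ * B₁) ^ i / (ρ * A₁) ^ n)) := by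
    intro w hw
    obtain ⟨hw1, hw2⟩ := hout hw
    have hw0 : 0 < w := hρA.trans hw1
    rw [Real.enorm_eq_ofReal_abs, abs_mul, abs_div, abs_pow, abs_pow, abs_of_pos hw0]
    refine ENNReal.ofReal_le_ofReal (mul_le_mul_of_nonneg_left ?_ (abs_nonneg _))
    exact div_le_div₀ (pow_nonneg (mul_pos hρ hB0).le i) (pow_le_pow_left₀ hw0.le hw2.le _)
      (pow_pos hρA _) (pow_le_pow_left₀ hρA.le hw1.le _)
  have hvol : volume I ≤ ENNReal.ofReal (ρ * (B₁ - A₁)) := by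
    calc volume I ≤ volume (Ioo (ρ * A₁) (ρ * B₁)) := measure_mono hout
      _ = ENNReal.ofReal (ρ * (B₁ - A₁)) := by rw [Real.volume_Ioo]; ring_nf
  -- the coefficient against the integral over the inner interval
  have hcoef := hsc Q ρ hρ i hi
  have hint : IntegrableOn (fun w => |psum N Q w|) (Icc (ρ * a₀) (ρ * b₀)) :=
    (continuous_psum N Q).abs.integrableOn_Icc
  have hle_ab : ρ * a₀ ≤ ρ * b₀ := by nlinarith
  have hreal : ENNReal.ofReal (∫ w in ρ * a₀..ρ * b₀, |psum N Q w|) ≤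
      ENNReal.ofReal ((ρ * B₁) ^ n) * ∫⁻ w in I, ‖psum N Q w * (1 / w) ^ n‖ₑ := by
    rw [intervalIntegral.integral_of_le hle_ab, ← Measure.restrict_congr_set Ioc_ae_eq_Icc.symm,
      ofReal_integral_eq_lintegral_ofReal hint (ae_of_all _ fun _ => abs_nonneg _)]
    calc ∫⁻ w in Icc (ρ * a₀) (ρ * b₀), ENNReal.ofReal |psum N Q w|
        ≤ ∫⁻ w in I, ENNReal.ofReal |psum N Q w| := lintegral_mono_set hin
      _ ≤ ∫⁻ w in I, ENNReal.ofReal ((ρ * B₁) ^ n) * ‖psum N Q w * (1 / w) ^ n‖ₑ := by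
          refine setLIntegral_mono ((measurable_rhs N n Q).const_mul _) fun w hw => ?_
          obtain ⟨hw1, hw2⟩ := hout hw
          have hw0 : 0 < w := hρA.trans hw1
          rw [Real.enorm_eq_ofReal_abs (psum N Q w * (1 / w) ^ n),
            ← ENNReal.ofReal_mul (pow_nonneg (mul_pos hρ hB0).le n)]
          refine ENNReal.ofReal_le_ofReal ?_
          rw [abs_mul, abs_of_pos (pow_pos (by positivity : (0 : ℝ) < 1 / w) n)]
          have hge : 1 ≤ (ρ * B₁) ^ n * (1 / w) ^ n := by
            rw [← mul_pow]
            refine one_le_pow₀ ?_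
            rw [mul_one_div, le_div_iff₀ hw0, one_mul]
            exact hw2.le
          calc |psum N Q w| = |psum N Q w| * 1 := (mul_one _).symm
            _ ≤ |psum N Q w| * ((ρ * B₁) ^ n * (1 / w) ^ n) := mul_le_mul_of_nonneg_left hge (abs_nonneg _)
            _ = (ρ * B₁) ^ n * (|psum N Q w| * (1 / w) ^ n) := by ring
      _ = ENNReal.ofReal ((ρ * B₁) ^ n) * ∫⁻ w in I, ‖psum N Q w * (1 / w) ^ n‖ₑ :=
          lintegral_const_mul _ (measurable_rhs N n Q)
  -- assemble
  have hBA : 0 ≤ B₁ - A₁ := by linarith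
  have hK0 : 0 ≤ M ^ N * (B₁ - A₁) / (A₁ ^ n * ρ ^ n) :=
    div_nonneg (mul_nonneg (by positivity) hBA) (by positivity)
  have hMi : B₁ ^ i ≤ M ^ N := (pow_le_pow_left₀ hB0.le (le_max_right _ _) _).trans
    (pow_le_pow_right₀ hM1 hi.le)
  calc ∫⁻ w in I, ‖Q i * (w ^ i / w ^ n)‖ₑ
      ≤ ∫⁻ _ in I, ENNReal.ofReal (|Q i| * ((ρ * B₁) ^ i / (ρ * A₁) ^ n)) := setLIntegral_mono measurable_const hpt
    _ = ENNReal.ofReal (|Q i| * ((ρ * B₁) ^ i / (ρ * A₁) ^ n)) * volume I := setLIntegral_const _ _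
    _ ≤ ENNReal.ofReal (|Q i| * ((ρ * B₁) ^ i / (ρ * A₁) ^ n)) * ENNReal.ofReal (ρ * (B₁ - A₁)) := by gcongr
    _ = ENNReal.ofReal (|Q i| * ρ ^ i * ρ) * ENNReal.ofReal (B₁ ^ i * (B₁ - A₁) / (A₁ ^ n * ρ ^ n)) := by
        rw [← ENNReal.ofReal_mul (by positivity), ← ENNReal.ofReal_mul (by positivity)]
        congr 1
        rw [mul_pow, mul_pow]
        field_simp
    _ ≤ ENNReal.ofReal (Cs * ∫ w in ρ * a₀..ρ * b₀, |psum N Q w|) *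
          ENNReal.ofReal (M ^ N * (B₁ - A₁) / (A₁ ^ n * ρ ^ n)) := by
        gcongr
    _ = ENNReal.ofReal (Cs * (M ^ N * (B₁ - A₁) / (A₁ ^ n * ρ ^ n))) *
          ENNReal.ofReal (∫ w in ρ * a₀..ρ * b₀, |psum N Q w|) := by
        rw [ENNReal.ofReal_mul hCs.le, ENNReal.ofReal_mul hCs.le]; ring
    _ ≤ ENNReal.ofReal (Cs * (M ^ N * (B₁ - A₁) / (A₁ ^ n * ρ ^ n))) *
          (ENNReal.ofReal ((ρ * B₁) ^ n) * ∫⁻ w in I, ‖psum N Q w * (1 / w) ^ n‖ₑ) := by gcongr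
    _ = ENNReal.ofReal Cr * ∫⁻ w in I, ‖psum N Q w * (1 / w) ^ n‖ₑ := by
        rw [← mul_assoc, ← ENNReal.ofReal_mul (mul_nonneg hCs.le hK0)]
        congr 2
        simp only [hCr]
        rw [mul_pow]
        field_simp

end SepThree

/-- **Moderate fibres** (registered part of `stub_separateThreeZero`; literal form of
`SepThree.moderate_fibre`): on a vertical fibre `I` containing a dilated interval `ρ[a₀, b₀]` and
contained in the dilated window `ρ(A₁, B₁)` away from the pole plane (`0 < A₁ < a₀ < b₀ < B₁`),
every weighted term `|Qᵢ| w^i/w^n` of a polynomial `∑_{j<N} Qⱼ w^j` is dominated in `L¹(I)` by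
`|∑ Qⱼ w^j| w^{-n}`, with a constant depending only on `N`, `n`, `a₀`, `b₀`, `A₁`, `B₁`. -/
theorem separateThree_pieces (N n : ℕ) (a₀ b₀ A₁ B₁ : ℝ) (hA : 0 < A₁) (h1 : A₁ < a₀) (h2 : a₀ < b₀) (h3 : b₀ < B₁) : ∃ C : ENNReal, C ≠ ⊤ ∧ ∀ (Q : ℕ → ℝ) (ρ : ℝ), 0 < ρ → ∀ (I : Set ℝ), MeasurableSet I → Set.Icc (ρ * a₀) (ρ * b₀) ⊆ I → I ⊆ Set.Ioo (ρ * A₁) (ρ * B₁) → ∀ i < N, MeasureTheory.lintegral (MeasureTheory.volume.restrict I) (fun w => ‖Q i * (w ^ i / w ^ n)‖ₑ) ≤ C * MeasureTheory.lintegral (MeasureTheory.volume.restrict I) (fun w => ‖(∑ j ∈ Finset.range N, Q j * w ^ j) * (1 / w) ^ n‖ₑ) := by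
  exact SepThree.moderate_fibre N n hA h1 h2 h3

end Summit.KontsevichZagierPeriods.ArrangementNormalForm.JanusBands
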